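import Summits.Ventures.WeilGRH.FlatWindowAtoms
import Summits.RiemannHypothesis.RiemannHypothesis.Theorems.WeilBochnerMeasureKernelChar
import Literature.NumberTheory.LFunctions.YoshidaWindowSpacesProofs
import HarnessLib

/-!
# GRH arm (rh-explicit, venture WeilGRH): EVERY `χ`-window measure integrates `(1 + t²)⁻¹` — the growth
  hypothesis of the flat-window identity discharged by a Fejér PAIR of kernels

Cell `rh-explicit`, WEIL TRACK (structure seat weil-3, gen9).  `TwistedWindowMeasure.lean`,
`FlatWindowSpectral.lean` and `FlatWindowAtoms.lean` carry the hypothesis `(1+t²)⁻¹ ∈ L¹(μ)` for the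
positive measure `μ` representing `Q_χ` on a window (for `ζ` it is gen4's growth law, for the zero-height
measure `ν_χ` it is the density of zeros).  HERE it is proved for EVERY representing measure, from
positivity alone: the kernel lemma `WeilBochnerMeasureKernelChar.weilFunctionalChar_kernel_eq_integral`
(continuous band-limited kernels with non-negative, quadratically decaying transform are `μ`-integrable)
applied to the TRIANGLE `χ_0 ⋆ χ̃_0` of half-width `b` (transform = the Fejér kernel
`2sin²(ct)/(ct²)`, `c = b/2`) and to its MODULATION `e^{−iθx}(χ_0 ⋆ χ̃_0)` with `θ = π/(2c)` (transform =
the Fejér kernel translated by `θ`); since `sin²(ct) + sin²(ct + π/2) = 1` the pair dominates `(1+t²)⁻¹`.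

* `weilMellin_modulate`: `(e^{iθx}f)^(½+iu) = f̂(½+i(u+θ))` (any `f`);
* `fejerPair_lower_bound`: `min(2c, (c(1+θ²))⁻¹)·(1+t²)⁻¹ ≤ F(t) + F(t+θ)`, `F = ‖χ̂_0(½+i·)‖²`;
* **`integrable_inv_one_add_sq_of_represents`**: for every `χ` (any modulus, any parity), `b > 0` and
  every positive `μ` representing `Q_χ` on the tests of `[-b, b]`: `(1+t²)⁻¹ ∈ L¹(μ)`;
* hypothesis-free corollaries **`flatWindow_sandwich'`**, **`flatWindow_add_atom_le_log'`**,
  **`two_mul_mul_atom_le_budget'`** (the flat-window sandwich, the atom-sharpened rung inequality, the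
  atom bound at every height — for EVERY representing measure; only `t⁻² ∈ L¹(μ)` remains, in the lower
  bound, as a genuine condition on the spectral mass near the centre).

No definitions, no named facts, RH/GRH-free.
-/

set_option autoImplicit false

noncomputable section

open Complex Filter Set MeasureTheory
open scoped Real Topology ComplexConjugate ArithmeticFunction.vonMangoldt

namespace Summit.Ventures.WeilGRH

open Literature.NumberTheory.LFunctions
open Literature.NumberTheory.LFunctions.Yoshida1992 (chi chi_mem_K integrable_of_mem_K
  continuous_weilConv_weilReflect_of_mem_K tsupport_weilConv_weilReflect_of_mem_K
  weilMellin_weilConv_weilReflect_half_of_integrable)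
open Summit.RiemannHypothesis.RiemannHypothesis.Theorems.WeilBochnerMeasureChar (weilFunctionalChar_kernel_eq_integral)

variable {q : ℕ} {c : ℝ}

/-! ## Modulation shifts the transform; the Fejér pair is bounded below by `(1+t²)⁻¹` -/

/-- **Modulation shifts the transform** (any function): `(e^{iθx}f)^(½+iu) = f̂(½+i(u+θ))`. -/
theorem weilMellin_modulate (θ : ℝ) (f : ℝ → ℂ) (u : ℝ) :
    weilMellin (fun x ↦ cexp (I * (θ * x : ℝ)) * f x) (1 / 2 + u * I) =
      weilMellin f (1 / 2 + ((u + θ : ℝ) : ℂ) * I) := by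
  unfold weilMellin
  refine integral_congr_ae (Eventually.of_forall fun x ↦ ?_)
  show cexp (I * (θ * x : ℝ)) * f x * cexp ((1 / 2 + (u : ℂ) * I - 1 / 2) * (x : ℂ)) =
    f x * cexp ((1 / 2 + ((u + θ : ℝ) : ℂ) * I - 1 / 2) * (x : ℂ))
  rw [mul_comm (cexp _) (f x), mul_assoc, ← Complex.exp_add]
  congr 2
  push_cast
  ring

/-- **The Fejér pair is bounded below**: with `θ = π/(2c)` (`c > 0`) and `F(t) = ‖χ̂_0(½+it)‖² = 2sin²(ct)/(ct²)`,
`min(2c, (c(1+θ²))⁻¹)·(1+t²)⁻¹ ≤ F(t) + F(t+θ)` for every `t` (`sin²(ct) + sin²(ct + π/2) = 1`, and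
`max(t², (t+θ)²) ≤ 2(1+θ²)(1+t²)`; at `t ∈ {0, −θ}` one of the two terms is the full window `2c`). -/
theorem fejerPair_lower_bound (hc : 0 < c) (t : ℝ) :
    min (2 * c) (1 / (c * (1 + (π / (2 * c)) ^ 2))) * (1 + t ^ 2)⁻¹ ≤
      ‖weilMellin (chi c 0) (1 / 2 + t * I)‖ ^ 2 +
        ‖weilMellin (chi c 0) (1 / 2 + ((t + π / (2 * c) : ℝ) : ℂ) * I)‖ ^ 2 := by
  set θ : ℝ := π / (2 * c) with hθ
  have hθ0 : 0 < θ := by positivity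
  set m : ℝ := min (2 * c) (1 / (c * (1 + θ ^ 2))) with hm
  have hm0 : 0 < m := lt_min (by linarith) (by positivity)
  have h1t : (1 + t ^ 2)⁻¹ ≤ 1 := inv_le_one_of_one_le₀ (by nlinarith)
  have hF0 : ∀ s : ℝ, 0 ≤ ‖weilMellin (chi c 0) (1 / 2 + s * I)‖ ^ 2 := fun s ↦ by positivity
  rcases eq_or_ne t 0 with rfl | ht
  · -- the first term is the full window `2c ≥ m`
    rw [norm_sq_weilMellin_chi_zero_zero hc]
    have := hF0 (0 + θ)
    calc m * (1 + (0 : ℝ) ^ 2)⁻¹ ≤ 2 * c * 1 := by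
          rw [zero_pow two_ne_zero, add_zero, inv_one]; exact mul_le_mul_of_nonneg_right (min_le_left _ _) zero_le_one
      _ ≤ _ := by push_cast at this ⊢; linarith
  rcases eq_or_ne (t + θ) 0 with hte | hte
  · -- the second term is the full window
    have e : ((t + θ : ℝ) : ℂ) = ((0 : ℝ) : ℂ) := by rw [hte]
    rw [e, norm_sq_weilMellin_chi_zero_zero hc]
    have := hF0 t
    calc m * (1 + t ^ 2)⁻¹ ≤ 2 * c * 1 :=
          mul_le_mul (min_le_left _ _) h1t (by positivity) (by linarith)
      _ ≤ _ := by linarith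
  -- generic point: `2sin²(ct)/(ct²) + 2cos²(ct)/(c(t+θ)²) ≥ 2/(c·max) ≥ (c(1+θ²))⁻¹ (1+t²)⁻¹`
  rw [norm_sq_weilMellin_chi_zero hc ht, norm_sq_weilMellin_chi_zero hc hte]
  have hcos : Real.sin (c * (t + θ)) ^ 2 = Real.cos (c * t) ^ 2 := by
    rw [mul_add, show c * θ = π / 2 by rw [hθ]; field_simp, Real.sin_add_pi_div_two]
  rw [hcos]
  set M : ℝ := max (t ^ 2) ((t + θ) ^ 2) with hM
  have hM0 : 0 < M := lt_of_lt_of_le (by positivity : (0 : ℝ) < t ^ 2) (le_max_left _ _)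
  have hsin2 := Real.sin_sq_add_cos_sq (c * t)
  -- each term is at least its value with the denominator replaced by `c·M`
  have h1 : 2 * Real.sin (c * t) ^ 2 / (c * M) ≤ 2 * Real.sin (c * t) ^ 2 / (c * t ^ 2) :=
    div_le_div_of_nonneg_left (by positivity) (by positivity) (mul_le_mul_of_nonneg_left (le_max_left _ _) hc.le)
  have h2 : 2 * Real.cos (c * t) ^ 2 / (c * M) ≤ 2 * Real.cos (c * t) ^ 2 / (c * (t + θ) ^ 2) :=
    div_le_div_of_nonneg_left (by positivity) (by positivity)
      (mul_le_mul_of_nonneg_left (le_max_right _ _) hc.le)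
  have hsum : 2 / (c * M) = 2 * Real.sin (c * t) ^ 2 / (c * M) + 2 * Real.cos (c * t) ^ 2 / (c * M) := by
    rw [← add_div, ← mul_add, hsin2, mul_one]
  -- `M ≤ 2(1+θ²)(1+t²)`
  have hMle : M ≤ 2 * (1 + θ ^ 2) * (1 + t ^ 2) := by
    refine max_le (by nlinarith [sq_nonneg θ, sq_nonneg t, sq_nonneg (θ * t)]) ?_
    nlinarith [sq_nonneg (t - θ), sq_nonneg θ, sq_nonneg t, sq_nonneg (θ * t)]
  have hkey : m * (1 + t ^ 2)⁻¹ ≤ 2 / (c * M) := by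
    calc m * (1 + t ^ 2)⁻¹ ≤ 1 / (c * (1 + θ ^ 2)) * (1 + t ^ 2)⁻¹ :=
          mul_le_mul_of_nonneg_right (min_le_right _ _) (by positivity)
      _ = 2 / (c * (2 * (1 + θ ^ 2) * (1 + t ^ 2))) := by field_simp
      _ ≤ 2 / (c * M) := div_le_div_of_nonneg_left (by norm_num) (by positivity)
          (mul_le_mul_of_nonneg_left hMle hc.le)
  linarith

/-! ## Every `χ`-window measure integrates `(1 + t²)⁻¹` -/

/-- **THE GROWTH HYPOTHESIS DISCHARGED.**  For every Dirichlet character `χ` (any modulus, any parity),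
every window `b > 0` and EVERY positive measure `μ` representing `Q_χ` on the tests of `[-b, b]`:
`(1 + t²)⁻¹ ∈ L¹(μ)`.  (The kernel lemma `weilFunctionalChar_kernel_eq_integral` makes the transforms of
the triangle `χ_0⋆χ̃_0` of half-width `b` and of its modulation by `θ = π/b` `μ`-integrable — they are the
Fejér kernel and its translate by `θ`, non-negative with quadratic decay — and the pair dominates
`(1+t²)⁻¹` by `fejerPair_lower_bound`.)  Consequently every hypothesis `(1+t²)⁻¹ ∈ L¹(μ)` in
`TwistedWindowMeasure` / `FlatWindowSpectral` / `FlatWindowAtoms` is automatic. -/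
theorem integrable_inv_one_add_sq_of_represents (χ : DirichletCharacter ℂ q) {b : ℝ} (hb : 0 < b)
    {μ : Measure ℝ}
    (hμ : ∀ g : ℝ → ℂ, IsWeilTest g → tsupport g ⊆ Icc (-b) b →
      Integrable (fun t : ℝ ↦ ‖weilMellin g (1 / 2 + t * I)‖ ^ 2) μ ∧
        weilQuadraticChar χ g = ((∫ t, ‖weilMellin g (1 / 2 + t * I)‖ ^ 2 ∂μ : ℝ) : ℂ)) :
    Integrable (fun t : ℝ ↦ (1 + t ^ 2)⁻¹) μ := by
  -- the triangle of half-width `b` (window `c = b/2`) and its modulation by `θ = π/(2c) = π/b`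
  set c : ℝ := b / 2 with hc
  have hc0 : 0 < c := by positivity
  set θ : ℝ := π / (2 * c) with hθ
  set k₁ : ℝ → ℂ := weilConv (chi c 0) (weilReflect (chi c 0)) with hk₁
  set k₂ : ℝ → ℂ := fun x ↦ cexp (I * ((-θ) * x : ℝ)) * k₁ x with hk₂
  have hK := chi_mem_K c 0
  have hk₁c : Continuous k₁ := continuous_weilConv_weilReflect_of_mem_K hK
  have hk₁t : tsupport k₁ ⊆ Icc (-(2 * c)) (2 * c) := tsupport_weilConv_weilReflect_of_mem_K hK
  have hk₂c : Continuous k₂ := by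
    have h1 : Continuous fun x : ℝ ↦ cexp (I * ((-θ) * x : ℝ)) :=
      Complex.continuous_exp.comp (continuous_const.mul (Complex.continuous_ofReal.comp
        (continuous_const.mul continuous_id)))
    exact h1.mul hk₁c
  have hk₂t : tsupport k₂ ⊆ Icc (-(2 * c)) (2 * c) :=
    (tsupport_mul_subset_right (f := fun x : ℝ ↦ cexp (I * ((-θ) * x : ℝ))) (g := k₁)).trans hk₁t
  have h2c : 2 * c < 2 * b := by rw [hc]; linarith
  -- transforms: the Fejér kernel and its translate
  set F : ℝ → ℝ := fun t ↦ ‖weilMellin (chi c 0) (1 / 2 + t * I)‖ ^ 2 with hF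
  have hF1 : ∀ u : ℝ, weilMellin k₁ (1 / 2 + u * I) = ((F u : ℝ) : ℂ) := fun u ↦
    weilMellin_weilConv_weilReflect_half_of_integrable (integrable_of_mem_K hK) u
  have hF2 : ∀ u : ℝ, weilMellin k₂ (1 / 2 + u * I) = ((F (u + -θ) : ℝ) : ℂ) := fun u ↦ by
    rw [hk₂, weilMellin_modulate, hF1]
  -- quadratic decay `F(u) ≤ (4c + 4/c)/(1+u²)`
  have hFdecay : ∀ u : ℝ, F u ≤ (4 * c + 4 / c) / (1 + u ^ 2) := by
    intro u
    rw [le_div_iff₀ (by positivity)]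
    rcases le_or_gt (u ^ 2) 1 with hu | hu
    · have h := norm_sq_weilMellin_chi_zero_le hc0 u
      have : F u * (1 + u ^ 2) ≤ 2 * c * 2 := mul_le_mul h (by linarith) (by positivity) (by positivity)
      have h4 : 0 ≤ 4 / c := by positivity
      linarith
    · have hu0 : u ≠ 0 := by rintro rfl; norm_num at hu
      have h := norm_sq_weilMellin_chi_zero_le_div hc0 hu0
      have hu2 : 0 < u ^ 2 := by positivity
      have : F u * (1 + u ^ 2) ≤ 2 / (c * u ^ 2) * (2 * u ^ 2) :=
        mul_le_mul h (by linarith) (by positivity) (by positivity)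
      have e : 2 / (c * u ^ 2) * (2 * u ^ 2) = 4 / c := by field_simp; ring
      have h4 : 0 ≤ 4 * c := by positivity
      linarith
  have hM1 : ∀ u : ℝ, ‖weilMellin k₁ (1 / 2 + u * I)‖ ≤ (4 * c + 4 / c) / (1 + u ^ 2) := fun u ↦ by
    rw [hF1, Complex.norm_real, Real.norm_of_nonneg (by positivity)]; exact hFdecay u
  have hM2 : ∀ u : ℝ, ‖weilMellin k₂ (1 / 2 + u * I)‖ ≤ 2 * (1 + θ ^ 2) * (4 * c + 4 / c) / (1 + u ^ 2) := by
    intro u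
    rw [hF2, Complex.norm_real, Real.norm_of_nonneg (by positivity)]
    have h := hFdecay (u + -θ)
    have hcmp : (1 + u ^ 2) ≤ 2 * (1 + θ ^ 2) * (1 + (u + -θ) ^ 2) := by
      nlinarith [sq_nonneg (u + -θ + θ), sq_nonneg (u + -θ - θ), sq_nonneg θ, sq_nonneg (θ * (u + -θ))]
    calc F (u + -θ) ≤ (4 * c + 4 / c) / (1 + (u + -θ) ^ 2) := h
      _ ≤ 2 * (1 + θ ^ 2) * (4 * c + 4 / c) / (1 + u ^ 2) := by
          rw [div_le_div_iff₀ (by positivity) (by positivity)]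
          have h0 : 0 ≤ 4 * c + 4 / c := by positivity
          nlinarith
  have hpos1 : ∀ u : ℝ, (weilMellin k₁ (1 / 2 + u * I)).im = 0 ∧ 0 ≤ (weilMellin k₁ (1 / 2 + u * I)).re :=
    fun u ↦ by rw [hF1]; exact ⟨Complex.ofReal_im _, by rw [Complex.ofReal_re]; positivity⟩
  have hpos2 : ∀ u : ℝ, (weilMellin k₂ (1 / 2 + u * I)).im = 0 ∧ 0 ≤ (weilMellin k₂ (1 / 2 + u * I)).re :=
    fun u ↦ by rw [hF2]; exact ⟨Complex.ofReal_im _, by rw [Complex.ofReal_re]; positivity⟩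
  -- the kernel lemma: both transforms are `μ`-integrable
  obtain ⟨hI1, -⟩ := weilFunctionalChar_kernel_eq_integral χ hb hμ hk₁c h2c hk₁t hM1 hpos1
  obtain ⟨hI2, -⟩ := weilFunctionalChar_kernel_eq_integral χ hb hμ hk₂c h2c hk₂t hM2 hpos2
  have hI : Integrable (fun t : ℝ ↦ F t + F (t + -θ)) μ := by
    refine (hI1.add hI2).congr (Eventually.of_forall fun t ↦ ?_)
    show (weilMellin k₁ (1 / 2 + t * I)).re + (weilMellin k₂ (1 / 2 + t * I)).re = F t + F (t + -θ)
    rw [hF1, hF2, Complex.ofReal_re, Complex.ofReal_re]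
  -- the Fejér pair (at `t − θ`, i.e. the pair `F(s), F(s+θ)` with `s = t − θ`) dominates `(1+t²)⁻¹`
  set m : ℝ := min (2 * c) (1 / (c * (1 + (π / (2 * c)) ^ 2))) with hm
  have hm0 : 0 < m := lt_min (by linarith) (by positivity)
  have hdom : ∀ t : ℝ, (1 + t ^ 2)⁻¹ ≤ (2 * (1 + θ ^ 2) / m) * (F t + F (t + -θ)) := by
    intro t
    have h := fejerPair_lower_bound hc0 (t + -θ)
    have e : t + -θ + π / (2 * c) = t := by rw [hθ]; ring
    rw [e] at h
    -- `(1+(t−θ)²)⁻¹ ≥ (1+t²)⁻¹ / (2(1+θ²))`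
    have hcmp : 1 + (t + -θ) ^ 2 ≤ 2 * (1 + θ ^ 2) * (1 + t ^ 2) := by
      nlinarith [sq_nonneg (t + θ), sq_nonneg θ, sq_nonneg t, sq_nonneg (θ * t)]
    have hinv : (1 + t ^ 2)⁻¹ ≤ 2 * (1 + θ ^ 2) * (1 + (t + -θ) ^ 2)⁻¹ := by
      rw [← one_div, ← one_div, ← div_eq_mul_one_div, div_le_div_iff₀ (by positivity) (by positivity)]
      linarith
    have hF0 : 0 ≤ F t + F (t + -θ) := by positivity
    calc (1 + t ^ 2)⁻¹ ≤ 2 * (1 + θ ^ 2) * (1 + (t + -θ) ^ 2)⁻¹ := hinv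
      _ = (2 * (1 + θ ^ 2) / m) * (m * (1 + (t + -θ) ^ 2)⁻¹) := by field_simp
      _ ≤ (2 * (1 + θ ^ 2) / m) * (F t + F (t + -θ)) := by
          refine mul_le_mul_of_nonneg_left ?_ (by positivity)
          linarith [h]
  have hcont : Continuous fun t : ℝ ↦ (1 + t ^ 2)⁻¹ :=
    (continuous_const.add (continuous_pow 2)).inv₀ fun t ↦ (by positivity : (0 : ℝ) < 1 + t ^ 2).ne'
  refine (hI.const_mul (2 * (1 + θ ^ 2) / m)).mono' hcont.aestronglyMeasurable (Eventually.of_forall fun t ↦ ?_)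
  rw [Real.norm_of_nonneg (by positivity)]
  exact hdom t

/-! ## The flat-window theorems with the growth hypothesis removed -/

/-- **THE FLAT-WINDOW SANDWICH, hypothesis-free form**: for `χ` mod `q ≠ 1`, `a > 0`, EVERY positive `μ`
representing `Q_χ` on the tests of `[-a, a]` with `t⁻² ∈ L¹(μ)`:
`log q − K_κ + I_κ(a)/a − 2a·μ{0} − (2/a)∫t⁻²dμ ≤ 2S_χ(a) ≤ log q − K_κ + I_κ(a)/a − 2a·μ{0}`. -/
theorem flatWindow_sandwich' (hq : q ≠ 1) (χ : DirichletCharacter ℂ q) {a : ℝ} (ha : 0 < a) {μ : Measure ℝ}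
    (hμ : ∀ g : ℝ → ℂ, IsWeilTest g → tsupport g ⊆ Icc (-a) a →
      Integrable (fun t : ℝ ↦ ‖weilMellin g (1 / 2 + t * I)‖ ^ 2) μ ∧
        weilQuadraticChar χ g = ((∫ t, ‖weilMellin g (1 / 2 + t * I)‖ ^ 2 ∂μ : ℝ) : ℂ))
    (hM : Integrable (fun t : ℝ ↦ (t ^ 2)⁻¹) μ) :
    Real.log q -
          (Real.log (4 * π) + Real.eulerMascheroniConstant +
            2 * ∫ t in Ioi (0 : ℝ), weilKillingDensityPar (charParity χ) t) +
          1 / a * (∫ t in Ioi (0 : ℝ), weilArchDensityPar (charParity χ) t * min t (2 * a)) -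
          2 * a * μ.real {0} - 2 / a * ∫ t, (t ^ 2)⁻¹ ∂μ ≤
        2 * (∑ n ∈ weilPrimeIndex a,
          (Λ n : ℝ) / Real.sqrt n * ((1 - Real.log n / (2 * a)) * (χ (n : ZMod q)).re)) ∧
      2 * (∑ n ∈ weilPrimeIndex a,
          (Λ n : ℝ) / Real.sqrt n * ((1 - Real.log n / (2 * a)) * (χ (n : ZMod q)).re)) ≤
        Real.log q -
          (Real.log (4 * π) + Real.eulerMascheroniConstant +
            2 * ∫ t in Ioi (0 : ℝ), weilKillingDensityPar (charParity χ) t) +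
          1 / a * (∫ t in Ioi (0 : ℝ), weilArchDensityPar (charParity χ) t * min t (2 * a)) -
          2 * a * μ.real {0} :=
  flatWindow_sandwich hq χ ha hμ (integrable_inv_one_add_sq_of_represents χ ha hμ) hM

/-- **The rung inequality sharpened by the atom, hypothesis-free**:
`2S_χ(a) + K_κ − I_κ(a)/a + 2a·μ{0} ≤ log q` for EVERY positive `μ` representing `Q_χ` on `[-a, a]`. -/
theorem flatWindow_add_atom_le_log' (hq : q ≠ 1) (χ : DirichletCharacter ℂ q) {a : ℝ} (ha : 0 < a)
    {μ : Measure ℝ}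
    (hμ : ∀ g : ℝ → ℂ, IsWeilTest g → tsupport g ⊆ Icc (-a) a →
      Integrable (fun t : ℝ ↦ ‖weilMellin g (1 / 2 + t * I)‖ ^ 2) μ ∧
        weilQuadraticChar χ g = ((∫ t, ‖weilMellin g (1 / 2 + t * I)‖ ^ 2 ∂μ : ℝ) : ℂ)) :
    2 * (∑ n ∈ weilPrimeIndex a,
          (Λ n : ℝ) / Real.sqrt n * ((1 - Real.log n / (2 * a)) * (χ (n : ZMod q)).re)) +
        (Real.log (4 * π) + Real.eulerMascheroniConstant +
          2 * ∫ t in Ioi (0 : ℝ), weilKillingDensityPar (charParity χ) t) -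
        1 / a * (∫ t in Ioi (0 : ℝ), weilArchDensityPar (charParity χ) t * min t (2 * a)) +
        2 * a * μ.real {0} ≤ Real.log q :=
  flatWindow_add_atom_le_log hq χ ha hμ (integrable_inv_one_add_sq_of_represents χ ha hμ)

/-- **One rung bounds the spectral mass at every height, hypothesis-free**: for `χ` mod `q ≠ 1`, `a > 0`,
EVERY positive `μ` representing `Q_χ` on `[-a, a]` and every `τ`:
`2a·μ{τ} ≤ log q − K_κ + [Re ψ(¼+iτ/2) − Re ψ(¼)] + 5/a + 2Σ_{log n<2a}Λ(n)n^{-1/2}(1 − log n/(2a))`. -/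
theorem two_mul_mul_atom_le_budget' (hq : q ≠ 1) (χ : DirichletCharacter ℂ q) {a : ℝ} (ha : 0 < a)
    {μ : Measure ℝ}
    (hμ : ∀ g : ℝ → ℂ, IsWeilTest g → tsupport g ⊆ Icc (-a) a →
      Integrable (fun t : ℝ ↦ ‖weilMellin g (1 / 2 + t * I)‖ ^ 2) μ ∧
        weilQuadraticChar χ g = ((∫ t, ‖weilMellin g (1 / 2 + t * I)‖ ^ 2 ∂μ : ℝ) : ℂ)) (τ : ℝ) :
    2 * a * μ.real {τ} ≤
      Real.log q - (Real.log (4 * π) + Real.eulerMascheroniConstant +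
          2 * ∫ t in Ioi (0 : ℝ), weilKillingDensityPar (charParity χ) t) +
        (Literature.Analysis.SpecialFunctions.reDigammaQuarter τ -
          Literature.Analysis.SpecialFunctions.reDigammaQuarter 0) + 5 / a +
        2 * (∑ n ∈ weilPrimeIndex a, (Λ n : ℝ) / Real.sqrt n * (1 - Real.log n / (2 * a))) :=
  two_mul_mul_atom_le_budget hq χ ha hμ (integrable_inv_one_add_sq_of_represents χ ha hμ) τ

end Summit.Ventures.WeilGRH

end
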